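import Summits.BirchSwinnertonDyer.BirchSwinnertonDyer.Theorems.ResidualThetaTransportAtTwoPollackPairKUnique
import Summits.BirchSwinnertonDyer.BirchSwinnertonDyer.Theorems.ResidualThetaTransportAtTwoResidualSignedLambdaLowerCMAtTwoNormLambdaSocket
import Summits.BirchSwinnertonDyer.BirchSwinnertonDyer.Theorems.ResidualThetaTransportAtTwoResidualSignedLambdaLowerCMAtTwoSelmerDualFinite
import Summits.BirchSwinnertonDyer.BirchSwinnertonDyer.Theorems.ResidualThetaTransportAtTwoDefs
import Mathlib.RingTheory.PowerSeries.WeierstrassPreparation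
import Summits.BirchSwinnertonDyer.BirchSwinnertonDyer.Theorems.ResidualThetaTransportAtTwoResidualSignedLambdaLowerCMAtTwoStationRCongruence
import Summits.BirchSwinnertonDyer.Rank1Residual.Additive.QuadraticBranchMinusLFunctionUnique
import HarnessLib

/-!
# Station (R) of line `onepair` (crux RSL_g, stmt-BirchSwinnertonDyer-22608) — the EVALUATION ROAD, part A
# (port of the stub-critic lineage's k3-g25 sketch `Cruxes/ResidualThetaCountLowerPureAtTwo/Sketch_sidea_k3_g25.lean`, §1 evaluation algebra and §2 rigidity (RIG))

Route `ResidualThetaTransportAtTwo` (RTT), crux `ResidualSignedLambdaLowerCMAtTwo` (stmt-BirchSwinnertonDyer-22608), line `onepair` v3f, station (R)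
`stub_kzgValueRelation`. Ported by seat `bsd-wall-tp2-p2x-w3` g18 (helper, `--supports … --as helper`, closes nothing) ON CONSUMPTION (STUB-PLAN S148 (iv));
the (R) port of memo `STATION-R-PORT-w3g18.md` (evidence #54 on 22608) feeds `hERL_of_scaledColumnValues_fixedMultiplier` (`μt ↦ 𝔯̃_e·μ̃`, `u := 2^a·3·q·δ`).
AUTHORSHIP: statements and proofs are the stub-ideation seat k3-g25's, graded PASS-substantive by the stub-critic (STUB-PLAN rev 27.3 row 98); this file
re-homes them under `…Theorems.ThetaTransport.StationR.Road`. THEOREMS ONLY (no definition, no instance, no notation, no `sorry`). BSD is not proved by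
anything here; 22608 / 26074 / 24105 OPEN / HOLD.

WHAT (part A): §1 evaluation algebra on `Λ_𝒪` at `ζ − 1` (multiplicativity, polynomial values, `ω_n ∣ G ⇒ G(ζ−1) = 0`, COL-ev, MTV-ev);
§2 RIGIDITY (RIG): vanishing at `ζ − 1` for all primitive `ζ` of order `p^{N+1}` ⇒ divisible by `Φ_{p^{N+1}}(1+T)`; along unboundedly many levels ⇒ `G = 0`.

References: [Pollack2003] Lemma 4.7, Prop. 6.9, Thm. 6.17, Prop. 6.18; [Kato2004Asterisque] Thm. 12.5 (1); [Washington1997] §7.1–7.2, Prop. 7.2/7.3.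
-/

set_option autoImplicit false
-- D-0017: single-problem summit, so `Summit.BirchSwinnertonDyer.BirchSwinnertonDyer.…` repeats a namespace BY DESIGN.
set_option linter.dupNamespace false
noncomputable section
open scoped Classical Polynomial
open Polynomial (X cyclotomic)
open Literature.NumberTheory.EllipticCurves Literature.NumberTheory.EllipticCurves.ModularForms
  CongruenceSubgroup Literature.NumberTheory.Automorphic
  Summit.BirchSwinnertonDyer.BirchSwinnertonDyer.Theorems.PollackPairK
  Summit.BirchSwinnertonDyer.BirchSwinnertonDyer.Theorems

namespace Summit.BirchSwinnertonDyer.BirchSwinnertonDyer.Theorems.ThetaTransport.StationR.Road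

/-! ## §1 Evaluation algebra on `Λ_𝒪` at torsion points  Throughout, the value of `L ∈ Λ_𝒪` at `z ∈ ℂ_p`, `‖z‖ < 1`, is written out as `∑' k, φ𝒪 (coeff k L) * z ^ k` with `φ𝒪 = (algebraMap ℚ̄_p ℂ_p) ∘ (𝒪 ↪ ℚ̄_p)` (no notation introduced). -/

section Eval

variable {p : ℕ} [hp : Fact p.Prime] (S : Set (PadicAlgCl p))

/-- Values respect subtraction on `Λ_𝒪`. [folklore] -/
theorem tsum_coeff_sub (F G : IwasawaAlgebraO S) {z : ℂ_[p]} (hz : ‖z‖ < 1) :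
    ∑' k, ((algebraMap (PadicAlgCl p) ℂ_[p]).comp (padicCoeffIntegers S).subtype)
        (PowerSeries.coeff k (F - G)) * z ^ k =
      (∑' k, ((algebraMap (PadicAlgCl p) ℂ_[p]).comp (padicCoeffIntegers S).subtype)
          (PowerSeries.coeff k F) * z ^ k) -
        ∑' k, ((algebraMap (PadicAlgCl p) ℂ_[p]).comp (padicCoeffIntegers S).subtype)
          (PowerSeries.coeff k G) * z ^ k := by
  rw [← ((summable_map_coeff_mul_pow _ (norm_coeff_toCp_le_one S F) hz).hasSum.sub
    (summable_map_coeff_mul_pow _ (norm_coeff_toCp_le_one S G) hz).hasSum).tsum_eq]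
  exact tsum_congr fun k ↦ by rw [map_sub, map_sub, sub_mul]

/-- The value of a polynomial `P ∈ 𝒪[T] ⊂ Λ_𝒪` is `P(z)`. [folklore] -/
theorem tsum_coeff_coe_polynomial (P : (padicCoeffIntegers S)[X]) (z : ℂ_[p]) :
    ∑' k, ((algebraMap (PadicAlgCl p) ℂ_[p]).comp (padicCoeffIntegers S).subtype)
        (PowerSeries.coeff k (P : IwasawaAlgebraO S)) * z ^ k =
      P.eval₂ ((algebraMap (PadicAlgCl p) ℂ_[p]).comp (padicCoeffIntegers S).subtype) z :=
  (hasSum_map_coeff_coe_mul_pow _ P z).tsum_eq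

/-- The value of the constant `C ν` is `ν`. [folklore] -/
theorem tsum_coeff_C (ν : padicCoeffIntegers S) (z : ℂ_[p]) :
    ∑' k, ((algebraMap (PadicAlgCl p) ℂ_[p]).comp (padicCoeffIntegers S).subtype)
        (PowerSeries.coeff k (PowerSeries.C ν : IwasawaAlgebraO S)) * z ^ k =
      ((algebraMap (PadicAlgCl p) ℂ_[p]).comp (padicCoeffIntegers S).subtype) ν := by
  rw [← Polynomial.coe_C, tsum_coeff_coe_polynomial, Polynomial.eval₂_C]

/-- The value of an integer polynomial `c ∈ ℤ[T] ⊂ Λ_𝒪` is `c(z)`. [folklore] -/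
theorem tsum_coeff_coe_map_int (c : ℤ[X]) (z : ℂ_[p]) :
    ∑' k, ((algebraMap (PadicAlgCl p) ℂ_[p]).comp (padicCoeffIntegers S).subtype)
        (PowerSeries.coeff k ((c.map (Int.castRingHom (padicCoeffIntegers S)) :
          (padicCoeffIntegers S)[X]) : IwasawaAlgebraO S)) * z ^ k =
      c.eval₂ (Int.castRingHom ℂ_[p]) z := by
  rw [tsum_coeff_coe_polynomial, Polynomial.eval₂_map,
    RingHom.ext_int (((algebraMap (PadicAlgCl p) ℂ_[p]).comp
      (padicCoeffIntegers S).subtype).comp (Int.castRingHom _)) (Int.castRingHom ℂ_[p])]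

/-- **`ω_n`-divisibility kills the value at every `ζ - 1`, `ζ^{p^n} = 1`.** [folklore] -/
theorem tsum_coeff_eq_zero_of_omega_dvd {n : ℕ} {G : IwasawaAlgebraO S}
    (h : (((cyclotomicOmega p n).map (Int.castRingHom (padicCoeffIntegers S)) :
      (padicCoeffIntegers S)[X]) : IwasawaAlgebraO S) ∣ G)
    {ζ : ℂ_[p]} (hζ : ζ ^ p ^ n = 1) :
    ∑' k, ((algebraMap (PadicAlgCl p) ℂ_[p]).comp (padicCoeffIntegers S).subtype)
        (PowerSeries.coeff k G) * (ζ - 1) ^ k = 0 := by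
  obtain ⟨H, rfl⟩ := h
  rw [tsum_mul_eval S _ _ (norm_sub_one_lt_one_of_pow_prime_pow_eq_one hζ), tsum_coeff_coe_map_int,
    NormLambdaSocket.eval₂_cyclotomicOmega_sub_one_eq_zero (Int.castRingHom ℂ_[p]) n hζ, zero_mul]

/-- **(COL-ev) The evaluated column congruence**: `ω_n ∣ Q + c·E` in `Λ_𝒪` gives
`Q(ζ-1) = -c(ζ-1) · E(ζ-1)` at every `ζ` with `ζ^{p^n} = 1`. [folklore] -/
theorem tsum_coeff_eq_neg_mul_of_omega_dvd_add {n : ℕ} {Q E : IwasawaAlgebraO S} {c : ℤ[X]}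
    (h : (((cyclotomicOmega p n).map (Int.castRingHom (padicCoeffIntegers S)) :
      (padicCoeffIntegers S)[X]) : IwasawaAlgebraO S) ∣
        Q + ((c.map (Int.castRingHom (padicCoeffIntegers S)) : (padicCoeffIntegers S)[X]) :
          IwasawaAlgebraO S) * E)
    {ζ : ℂ_[p]} (hζ : ζ ^ p ^ n = 1) :
    ∑' k, ((algebraMap (PadicAlgCl p) ℂ_[p]).comp (padicCoeffIntegers S).subtype)
        (PowerSeries.coeff k Q) * (ζ - 1) ^ k =
      -(c.eval₂ (Int.castRingHom ℂ_[p]) (ζ - 1)) *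
        ∑' k, ((algebraMap (PadicAlgCl p) ℂ_[p]).comp (padicCoeffIntegers S).subtype)
          (PowerSeries.coeff k E) * (ζ - 1) ^ k := by
  have hz := norm_sub_one_lt_one_of_pow_prime_pow_eq_one hζ
  have h0 := tsum_coeff_eq_zero_of_omega_dvd S h hζ
  rw [tsum_add_eval S _ _ hz, tsum_mul_eval S _ _ hz, tsum_coeff_coe_map_int] at h0
  linear_combination h0

/-- **(MTV-ev) An integral congruence `p^k (ι μ̃ · θ − ι L) ∈ ω_n · ι Λ_𝒪` evaluates**:
`μ̃(ζ-1) · θ(ζ-1) = L(ζ-1)` at every `ζ` with `ζ^{p^n} = 1` (`p^k ≠ 0`, `ω_n(ζ-1) = 0`). [folklore] -/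
theorem tsum_mul_eval₂_eq_tsum_of_congr {n : ℕ} {θ : (PadicAlgCl p)[X]}
    {μt L : IwasawaAlgebraO S}
    (h : ∃ (k : ℕ) (q : IwasawaAlgebraO S), PowerSeries.C ((p : PadicAlgCl p) ^ k) *
      (iwasawaOToPowerSeries S μt * ((θ : (PadicAlgCl p)[X]) : PowerSeries (PadicAlgCl p)) -
        iwasawaOToPowerSeries S L) =
      (((cyclotomicOmega p n).map (Int.castRingHom (PadicAlgCl p)) : (PadicAlgCl p)[X]) :
        PowerSeries (PadicAlgCl p)) * iwasawaOToPowerSeries S q)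
    {ζ : ℂ_[p]} (hζ : ζ ^ p ^ n = 1) :
    (∑' k, ((algebraMap (PadicAlgCl p) ℂ_[p]).comp (padicCoeffIntegers S).subtype)
        (PowerSeries.coeff k μt) * (ζ - 1) ^ k) *
        θ.eval₂ (algebraMap (PadicAlgCl p) ℂ_[p]) (ζ - 1) =
      ∑' k, ((algebraMap (PadicAlgCl p) ℂ_[p]).comp (padicCoeffIntegers S).subtype)
        (PowerSeries.coeff k L) * (ζ - 1) ^ k := by
  obtain ⟨k, q, hq⟩ := h
  set φ : PadicAlgCl p →+* ℂ_[p] := algebraMap (PadicAlgCl p) ℂ_[p] with hφ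
  have hz : ‖ζ - 1‖ < 1 := norm_sub_one_lt_one_of_pow_prime_pow_eq_one hζ
  -- coefficient bounds
  have hI : ∀ (L' : IwasawaAlgebraO S) (j : ℕ),
      ‖φ (PowerSeries.coeff j (iwasawaOToPowerSeries S L'))‖ ≤ 1 := fun L' j ↦
    (PadicComplex.norm_extends (p := p) _).trans_le (norm_coeff_iwasawaOToPowerSeries_le_one S L' j)
  obtain ⟨Cθ, hCθ⟩ := NormLambdaSocket.exists_norm_coeff_coe_le φ θ
  obtain ⟨Cω, hCω⟩ := NormLambdaSocket.exists_norm_coeff_coe_le φ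
    ((cyclotomicOmega p n).map (Int.castRingHom (PadicAlgCl p)))
  have hA : ∀ j, ‖φ (PowerSeries.coeff j (iwasawaOToPowerSeries S μt *
      ((θ : (PadicAlgCl p)[X]) : PowerSeries (PadicAlgCl p))))‖ ≤ 1 * Cθ := fun j ↦
    NormLambdaSocket.norm_map_coeff_mul_le φ (hI μt) hCθ j
  have hpk : ∀ j, ‖φ (PowerSeries.coeff j (PowerSeries.C ((p : PadicAlgCl p) ^ k)))‖ ≤
      ‖φ ((p : PadicAlgCl p) ^ k)‖ := by
    intro j
    rw [PowerSeries.coeff_C]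
    split_ifs
    · exact le_rfl
    · rw [map_zero, norm_zero]; exact norm_nonneg _
  have hAB : ∀ j, ‖φ (PowerSeries.coeff j (iwasawaOToPowerSeries S μt *
      ((θ : (PadicAlgCl p)[X]) : PowerSeries (PadicAlgCl p)) - iwasawaOToPowerSeries S L))‖ ≤
        max (1 * Cθ) 1 := by
    intro j
    rw [map_sub, map_sub, sub_eq_add_neg]
    refine (IsUltrametricDist.norm_add_le_max _ _).trans ?_
    rw [norm_neg]
    exact max_le_max (hA j) (hI L j)
  -- evaluate both sides of the congruence
  have hev : ∑' j, φ (PowerSeries.coeff j (PowerSeries.C ((p : PadicAlgCl p) ^ k) *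
      (iwasawaOToPowerSeries S μt * ((θ : (PadicAlgCl p)[X]) : PowerSeries (PadicAlgCl p)) -
        iwasawaOToPowerSeries S L))) * (ζ - 1) ^ j =
      ∑' j, φ (PowerSeries.coeff j ((((cyclotomicOmega p n).map (Int.castRingHom (PadicAlgCl p)) :
        (PadicAlgCl p)[X]) : PowerSeries (PadicAlgCl p)) * iwasawaOToPowerSeries S q)) *
          (ζ - 1) ^ j := by
    rw [hq]
  have hC : ∑' j, φ (PowerSeries.coeff j (PowerSeries.C ((p : PadicAlgCl p) ^ k))) * (ζ - 1) ^ j =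
      φ ((p : PadicAlgCl p) ^ k) := by
    rw [← Polynomial.coe_C, (hasSum_map_coeff_coe_mul_pow φ _ _).tsum_eq, Polynomial.eval₂_C]
  rw [tsum_map_coeff_mul_mul_pow φ hpk hAB hz, tsum_map_coeff_mul_mul_pow φ hCω (hI q) hz, hC,
    (hasSum_map_coeff_coe_mul_pow φ _ _).tsum_eq,
    Polynomial.eval₂_map, RingHom.ext_int (φ.comp (Int.castRingHom _)) (Int.castRingHom ℂ_[p]),
    NormLambdaSocket.eval₂_cyclotomicOmega_sub_one_eq_zero (Int.castRingHom ℂ_[p]) n hζ,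
    zero_mul] at hev
  have hpk0 : φ ((p : PadicAlgCl p) ^ k) ≠ 0 := by
    rw [map_pow, map_natCast]; exact pow_ne_zero _ (Nat.cast_ne_zero.mpr hp.out.ne_zero)
  have hdiff := (mul_eq_zero.mp hev).resolve_left hpk0
  have hsplit : ∑' j, φ (PowerSeries.coeff j (iwasawaOToPowerSeries S μt *
      ((θ : (PadicAlgCl p)[X]) : PowerSeries (PadicAlgCl p)) - iwasawaOToPowerSeries S L)) *
        (ζ - 1) ^ j =
      (∑' j, φ (PowerSeries.coeff j (iwasawaOToPowerSeries S μt *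
        ((θ : (PadicAlgCl p)[X]) : PowerSeries (PadicAlgCl p)))) * (ζ - 1) ^ j) -
        ∑' j, φ (PowerSeries.coeff j (iwasawaOToPowerSeries S L)) * (ζ - 1) ^ j := by
    rw [← ((summable_map_coeff_mul_pow φ hA hz).hasSum.sub
      (summable_map_coeff_mul_pow φ (hI L) hz).hasSum).tsum_eq]
    exact tsum_congr fun j ↦ by simp only [map_sub, sub_mul]
  have hdiff' := hdiff
  rw [hsplit, tsum_map_coeff_mul_mul_pow φ (hI μt) hCθ hz,
    (hasSum_map_coeff_coe_mul_pow φ _ _).tsum_eq, sub_eq_zero] at hdiff'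
  -- identify the `𝒪`-coefficients with their images in `ℚ̄_p`
  have hcoe : ∀ (L' : IwasawaAlgebraO S),
      ∑' j, φ (PowerSeries.coeff j (iwasawaOToPowerSeries S L')) * (ζ - 1) ^ j =
        ∑' j, ((algebraMap (PadicAlgCl p) ℂ_[p]).comp (padicCoeffIntegers S).subtype)
          (PowerSeries.coeff j L') * (ζ - 1) ^ j := fun L' ↦
    tsum_congr fun j ↦ by rw [coeff_iwasawaOToPowerSeries, RingHom.comp_apply, Subring.subtype_apply]
  rw [← hcoe μt, ← hcoe L]
  exact hdiff'

/-- **(COL-ev is DATUM-FREE)**: two elements `Q₁, Q₂ ∈ Λ_𝒪` both congruent to `−c·E` modulo `ω_n` (e.g. the pairing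
polynomials `P⃗_{n}(z)` of two Honda data admitted by ONE column `E`) have the SAME value at every `ζ - 1`, `ζ^{p^n} = 1` —
on the evaluation road the «∀ admitted Honda datum» quantifier of the relay's print hypothesis carries no extra content at
torsion points. [folklore] -/
theorem tsum_coeff_eq_of_omega_dvd_add_of_omega_dvd_add {n : ℕ} {Q₁ Q₂ E : IwasawaAlgebraO S} {c : ℤ[X]}
    (h₁ : (((cyclotomicOmega p n).map (Int.castRingHom (padicCoeffIntegers S)) :
      (padicCoeffIntegers S)[X]) : IwasawaAlgebraO S) ∣
        Q₁ + ((c.map (Int.castRingHom (padicCoeffIntegers S)) : (padicCoeffIntegers S)[X]) :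
          IwasawaAlgebraO S) * E)
    (h₂ : (((cyclotomicOmega p n).map (Int.castRingHom (padicCoeffIntegers S)) :
      (padicCoeffIntegers S)[X]) : IwasawaAlgebraO S) ∣
        Q₂ + ((c.map (Int.castRingHom (padicCoeffIntegers S)) : (padicCoeffIntegers S)[X]) :
          IwasawaAlgebraO S) * E)
    {ζ : ℂ_[p]} (hζ : ζ ^ p ^ n = 1) :
    ∑' k, ((algebraMap (PadicAlgCl p) ℂ_[p]).comp (padicCoeffIntegers S).subtype)
        (PowerSeries.coeff k Q₁) * (ζ - 1) ^ k =
      ∑' k, ((algebraMap (PadicAlgCl p) ℂ_[p]).comp (padicCoeffIntegers S).subtype)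
        (PowerSeries.coeff k Q₂) * (ζ - 1) ^ k := by
  rw [tsum_coeff_eq_neg_mul_of_omega_dvd_add S h₁ hζ, tsum_coeff_eq_neg_mul_of_omega_dvd_add S h₂ hζ]

end Eval

/-! ## §2 (RIG) Rigidity over `𝒪`: vanishing at all primitive `p^{N+1}`-torsion points -/

section Rigidity

variable {p : ℕ} [hp : Fact p.Prime] (S : Set (PadicAlgCl p))

omit hp in
/-- `Φ_{p^{N+1}}(1+T) ∣ ω_{N+1} = (1+T)^{p^{N+1}} - 1` in `ℤ[T]`. [folklore] -/
theorem cyclotomic_comp_dvd_cyclotomicOmega (N : ℕ) :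
    (cyclotomic (p ^ (N + 1)) ℤ).comp (X + 1) ∣ cyclotomicOmega p (N + 1) := by
  obtain ⟨c, hc⟩ := Polynomial.cyclotomic.dvd_X_pow_sub_one (p ^ (N + 1)) ℤ
  refine ⟨c.comp (X + 1), ?_⟩
  rw [← Polynomial.mul_comp, ← hc, cyclotomicOmega, Polynomial.sub_comp, Polynomial.X_pow_comp,
    Polynomial.one_comp]

omit hp in
/-- `deg Φ_{p^{N+1}}(1+T) = φ(p^{N+1})`. [folklore] -/
theorem natDegree_cyclotomic_comp (N : ℕ) :
    ((cyclotomic (p ^ (N + 1)) ℤ).comp (X + 1)).natDegree = Nat.totient (p ^ (N + 1)) := by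
  have h1 : ((X : ℤ[X]) + 1) = X + Polynomial.C 1 := by rw [Polynomial.C_1]
  rw [Polynomial.natDegree_comp, h1, Polynomial.natDegree_X_add_C, mul_one,
    Polynomial.natDegree_cyclotomic]

/-- `Φ_{p^{N+1}}(1+T)` vanishes at `ζ - 1` for `ζ` a primitive `p^{N+1}`-th root of unity. [folklore] -/
theorem eval₂_cyclotomic_comp_sub_one_eq_zero (N : ℕ) {ζ : ℂ_[p]}
    (hζ : IsPrimitiveRoot ζ (p ^ (N + 1))) :
    ((cyclotomic (p ^ (N + 1)) ℤ).comp (X + 1)).eval₂ (Int.castRingHom ℂ_[p]) (ζ - 1) = 0 := by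
  rw [Polynomial.eval₂_comp, Polynomial.eval₂_add, Polynomial.eval₂_X, Polynomial.eval₂_one,
    sub_add_cancel, Polynomial.eval₂_eq_eval_map, Polynomial.map_cyclotomic_int]
  exact (hζ.isRoot_cyclotomic (pow_pos hp.out.pos _)).eq_zero

/-- The `𝒪 → ℂ_p` coefficient map is injective. [folklore] -/
theorem injective_toCp :
    Function.Injective ((algebraMap (PadicAlgCl p) ℂ_[p]).comp (padicCoeffIntegers S).subtype) :=
  (algebraMap (PadicAlgCl p) ℂ_[p]).injective.comp Subtype.val_injective

/-- `𝒪 = 𝒪_{K_g}` is `𝔪`-adically complete (DVR, finite over `ℤ_p`). [folklore] -/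
theorem isAdicComplete_padicCoeffIntegers [FiniteDimensional ℚ_[p] (padicCoeffField S)] :
    haveI : IsDiscreteValuationRing (padicCoeffIntegers S) := isDiscreteValuationRing_padicCoeffIntegers
    IsAdicComplete (IsLocalRing.maximalIdeal (padicCoeffIntegers S)) (padicCoeffIntegers S) := by
  haveI : IsDiscreteValuationRing (padicCoeffIntegers S) := isDiscreteValuationRing_padicCoeffIntegers
  obtain ⟨ϖ, hϖ⟩ := IsDiscreteValuationRing.exists_irreducible (padicCoeffIntegers S)
  have hm : IsLocalRing.maximalIdeal (padicCoeffIntegers S) = Ideal.span {ϖ} :=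
    (IsDiscreteValuationRing.irreducible_iff_uniformizer ϖ).mp hϖ
  haveI : IsPrecomplete (IsLocalRing.maximalIdeal (padicCoeffIntegers S)) (padicCoeffIntegers S) := by
    rw [hm]; exact LambdaLowerBoundO.isPrecomplete_span_of_irreducible S hϖ
  exact { (inferInstance : IsHausdorff (IsLocalRing.maximalIdeal (padicCoeffIntegers S))
      (padicCoeffIntegers S)),
    (inferInstance : IsPrecomplete (IsLocalRing.maximalIdeal (padicCoeffIntegers S))
      (padicCoeffIntegers S)) with }

/-- **(RIG, one level) `G ∈ Λ_𝒪` vanishing at `ζ - 1` for every primitive `p^{N+1}`-th root of unity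
`ζ ∈ ℂ_p` is divisible by `Φ_{p^{N+1}}(1+T)` in `Λ_𝒪`**: Weierstrass-divide `G` by the distinguished
polynomial `Φ_{p^{N+1}}(1+T)` (residually `T^{φ(p^{N+1})}`); the remainder is a polynomial over `𝒪` of
degree `< φ(p^{N+1})` with `φ(p^{N+1})` distinct roots `ζ - 1`, hence zero. [folklore] -/
theorem cyclotomic_comp_dvd_of_forall_tsum_eq_zero [FiniteDimensional ℚ_[p] (padicCoeffField S)]
    (N : ℕ) {G : IwasawaAlgebraO S}
    (h : ∀ ζ : ℂ_[p], IsPrimitiveRoot ζ (p ^ (N + 1)) →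
      ∑' k, ((algebraMap (PadicAlgCl p) ℂ_[p]).comp (padicCoeffIntegers S).subtype)
        (PowerSeries.coeff k G) * (ζ - 1) ^ k = 0) :
    ((((cyclotomic (p ^ (N + 1)) ℤ).comp (X + 1)).map (Int.castRingHom (padicCoeffIntegers S)) :
      (padicCoeffIntegers S)[X]) : IwasawaAlgebraO S) ∣ G := by
  haveI : IsDiscreteValuationRing (padicCoeffIntegers S) := isDiscreteValuationRing_padicCoeffIntegers
  haveI : CharP (IsLocalRing.ResidueField (padicCoeffIntegers S)) p :=
    charP_residueField_padicCoeffIntegers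
  haveI : IsAdicComplete (IsLocalRing.maximalIdeal (padicCoeffIntegers S)) (padicCoeffIntegers S) :=
    isAdicComplete_padicCoeffIntegers S
  set φO : padicCoeffIntegers S →+* ℂ_[p] :=
    (algebraMap (PadicAlgCl p) ℂ_[p]).comp (padicCoeffIntegers S).subtype with hφO
  set Φ : ℤ[X] := (cyclotomic (p ^ (N + 1)) ℤ).comp (X + 1) with hΦ
  set D : IwasawaAlgebraO S :=
    ((Φ.map (Int.castRingHom (padicCoeffIntegers S)) : (padicCoeffIntegers S)[X]) :
      IwasawaAlgebraO S) with hD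
  have hres : PowerSeries.map (IsLocalRing.residue (padicCoeffIntegers S)) D =
      PowerSeries.X ^ Φ.natDegree :=
    map_residue_coe_eq_X_pow p (monic_cyclotomic_comp_X_add_one _)
      (cyclotomic_comp_dvd_cyclotomicOmega N)
  have hD0 : PowerSeries.map (IsLocalRing.residue (padicCoeffIntegers S)) D ≠ 0 := by
    rw [hres]; exact pow_ne_zero _ PowerSeries.X_ne_zero
  have hdiv := PowerSeries.eq_mul_weierstrassDiv_add_weierstrassMod G hD0
  set r : (padicCoeffIntegers S)[X] := G %ʷ D with hr
  -- the remainder vanishes at every `ζ - 1`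
  have hz1 : ∀ ζ : ℂ_[p], IsPrimitiveRoot ζ (p ^ (N + 1)) → (r.map φO).eval (ζ - 1) = 0 := by
    intro ζ hζ
    have hz : ‖ζ - 1‖ < 1 := norm_sub_one_lt_one_of_pow_prime_pow_eq_one hζ.pow_eq_one
    have hG := h ζ hζ
    rw [hdiv, tsum_add_eval S _ _ hz, tsum_mul_eval S _ _ hz, tsum_coeff_coe_map_int,
      eval₂_cyclotomic_comp_sub_one_eq_zero N hζ, zero_mul, zero_add,
      tsum_coeff_coe_polynomial] at hG
    rw [Polynomial.eval_map]
    exact hG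
  -- degree count
  have hdeg : r.degree < (Φ.natDegree : ℕ) := by
    have := PowerSeries.degree_weierstrassMod_lt G D (A := padicCoeffIntegers S)
    rw [hres, PowerSeries.order_X_pow] at this
    simpa using this
  have hr0 : r = 0 := by
    by_contra hr0
    obtain ⟨ζ₀, hζ₀⟩ := Summit.BirchSwinnertonDyer.Rank1Residual.Additive.exists_isPrimitiveRoot_padicComplex' (p := p) (N + 1)
    have hcard : (r.map φO).natDegree <
        ((primitiveRoots (p ^ (N + 1)) ℂ_[p]).image fun ζ : ℂ_[p] ↦ ζ - 1).card := by
      rw [Finset.card_image_of_injective _ (sub_left_injective), hζ₀.card_primitiveRoots,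
        ← natDegree_cyclotomic_comp N]
      exact (Polynomial.natDegree_map_le).trans_lt
        ((Polynomial.natDegree_lt_iff_degree_lt hr0).mpr hdeg)
    have hzero := Polynomial.eq_zero_of_natDegree_lt_card_of_eval_eq_zero' (r.map φO)
      ((primitiveRoots (p ^ (N + 1)) ℂ_[p]).image fun ζ : ℂ_[p] ↦ ζ - 1) (by
        intro x hx
        obtain ⟨ζ, hζ, rfl⟩ := Finset.mem_image.mp hx
        exact hz1 ζ ((mem_primitiveRoots (pow_pos hp.out.pos _)).mp hζ)) hcard
    exact hr0 (Polynomial.map_injective φO (injective_toCp S) (by rw [hzero, Polynomial.map_zero]))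
  refine ⟨G /ʷ D, ?_⟩
  rw [hr0, Polynomial.coe_zero, add_zero] at hdiv
  exact hdiv

/-- **(RIG) Rigidity over `𝒪`**: `G ∈ Λ_𝒪` vanishing at `ζ - 1` for every primitive `ζ` of order
`p^{ℓ_i + 1}` along a family of levels `ℓ_i` that is unbounded is `0` — every `Φ_{p^{ℓ_i+1}}(1+T)`
divides `G` (one level), and a nonzero element of `Λ_𝒪` has only finitely many such divisors
(landed `eq_zero_of_forall_dvd_of_map_eq_X_pow`). [folklore] -/
theorem eq_zero_of_forall_primitive_tsum_eq_zero [FiniteDimensional ℚ_[p] (padicCoeffField S)]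
    {G : IwasawaAlgebraO S} (ℓ : ℕ → ℕ) (hℓ : ∀ m : ℕ, ∃ i, m < ℓ i)
    (h : ∀ (i : ℕ) (ζ : ℂ_[p]), IsPrimitiveRoot ζ (p ^ (ℓ i + 1)) →
      ∑' k, ((algebraMap (PadicAlgCl p) ℂ_[p]).comp (padicCoeffIntegers S).subtype)
        (PowerSeries.coeff k G) * (ζ - 1) ^ k = 0) :
    G = 0 := by
  haveI : IsDiscreteValuationRing (padicCoeffIntegers S) := isDiscreteValuationRing_padicCoeffIntegers
  haveI : CharP (IsLocalRing.ResidueField (padicCoeffIntegers S)) p :=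
    charP_residueField_padicCoeffIntegers
  refine eq_zero_of_forall_dvd_of_map_eq_X_pow
    (fun i ↦ (((((cyclotomic (p ^ (ℓ i + 1)) ℤ).comp (X + 1)).map
      (Int.castRingHom (padicCoeffIntegers S)) : (padicCoeffIntegers S)[X]) : IwasawaAlgebraO S)))
    (fun i ↦ ((cyclotomic (p ^ (ℓ i + 1)) ℤ).comp (X + 1)).natDegree)
    (fun i ↦ map_residue_coe_eq_X_pow p (monic_cyclotomic_comp_X_add_one _)
      (cyclotomic_comp_dvd_cyclotomicOmega (ℓ i)))
    (fun m ↦ ?_) (fun i ↦ cyclotomic_comp_dvd_of_forall_tsum_eq_zero S (ℓ i) (h i))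
  obtain ⟨i, hi⟩ := hℓ m
  refine ⟨i, ?_⟩
  rw [natDegree_cyclotomic_comp, Nat.totient_prime_pow_succ hp.out]
  calc m < ℓ i := hi
    _ < p ^ ℓ i := Nat.lt_pow_self hp.out.one_lt
    _ ≤ p ^ ℓ i * (p - 1) := Nat.le_mul_of_pos_right _ (Nat.sub_pos_of_lt hp.out.one_lt)

end Rigidity

end Summit.BirchSwinnertonDyer.BirchSwinnertonDyer.Theorems.ThetaTransport.StationR.Road

end
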